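import Summits.CriticalPhenomena.Ising3DConformalLimit.Theorems.IsingEuclidUpgradeR4NonGaussianDefs
import HarnessLib

/-!
# Crux `IsingEuclidUpgradeR4NonGaussian` (stmt-CriticalPhenomena-0636),
# line `free-covariance-delta-dichotomy`: registered stub `stub_lamperti` (Lamperti's lever)

A non-degenerate pointwise scaling limit `S` of the critical Ising₃ correlators (`ρ > 0` on `(0,1]`)
has ONE exponent `Δ ∈ [1/2, 1]` such that `ρ` is regularly varying of index `-Δ` along `δ → 0⁺`
(`HasIndex ρ Δ`) AND `S` is scale covariant with dimension `Δ` on non-coincident configurations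
(`ScaleCovariantOn Δ S`). Everything is in the tree: covariance + ratio =
`HasPointwiseScalingLimit.exists_rpow_scale_and_ratio` (Lamperti-type statement, derived from the
full-filter limit), the window `[1/2, 1]` = `scalingDimension_mem_Icc_holds` applied to the
normalised family `S·𝟙_{injective}` (as in `exists_rpow_scale_mem_Icc`).

References: J. Lamperti, Trans. AMS 104 (1962) Thm 2; Bingham–Goldie–Teugels (1987) §8.5;
Di Francesco–Mathieu–Sénéchal (1997) §4.3.1.
-/

noncomputable section

namespace Summit.CriticalPhenomena.Ising3DConformalLimit.Cruxes.IsingEuclidUpgradeR4NonGaussian.FreeCovarianceDeltaDichotomy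

open Literature.Probability.LatticeModels Filter Set
open scoped Topology

/-- **Registered stub `stub_lamperti`** (line `free-covariance-delta-dichotomy` of crux
stmt-CriticalPhenomena-0636): every non-degenerate pointwise scaling limit of `criticalCorr 3` with
`ρ > 0` on `(0,1]` has an exponent `Δ ∈ [1/2,1]` with `HasIndex ρ Δ` (regular variation of the
renormalisation, index `-Δ`) and `ScaleCovariantOn Δ S`. [cite: BinghamGoldieTeugels1987, §8.5] -/
theorem stub_lamperti :
    ∀ (ρ : ℝ → ℝ) (S : CorrFamily 3), (∀ δ ∈ Set.Ioc (0:ℝ) 1, 0 < ρ δ) →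
      HasPointwiseScalingLimit (criticalCorr 3) ρ S → IsNondegenerateTwoPoint S →
      ∃ Δ : ℝ, 1/2 ≤ Δ ∧ Δ ≤ 1 ∧ HasIndex ρ Δ ∧ ScaleCovariantOn Δ S := by
  classical
  intro ρ S hρ hlim hnd
  obtain ⟨Δ, -, hcov, hratio⟩ := hlim.exists_rpow_scale_and_ratio (by norm_num) hρ hnd
  -- the window `[1/2, 1]` through the normalised family
  set S' : CorrFamily 3 := fun n z => if Function.Injective z then S n z else 0 with hS'
  have S'_inj : ∀ {n : ℕ} {z : Fin n → EuclideanSpace ℝ (Fin 3)}, Function.Injective z →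
      S' n z = S n z := fun hz => by simp only [hS', if_pos hz]
  have S'_ninj : ∀ {n : ℕ} {z : Fin n → EuclideanSpace ℝ (Fin 3)}, ¬ Function.Injective z →
      S' n z = 0 := fun hz => by simp only [hS', if_neg hz]
  have hlim' : HasPointwiseScalingLimit (criticalCorr 3) ρ S' :=
    fun n => (hlim n).congr_right fun z hz => (S'_inj hz).symm
  have hnd' : IsNondegenerateTwoPoint S' := fun z hz => by rw [S'_inj hz]; exact hnd z hz
  have hsc' : IsScaleCovariant Δ S' := by
    intro n c hc z
    by_cases hz : Function.Injective z
    · have hz' : Function.Injective (fun i => c • z i) := smul_mem_nonCoincident hc.ne' hz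
      rw [S'_inj hz', S'_inj hz]
      exact hcov n c hc z hz
    · have hz' : ¬ Function.Injective (fun i => c • z i) := fun h =>
        hz ((smul_right_injective (EuclideanSpace ℝ (Fin 3)) hc.ne').of_comp_iff z |>.1 h)
      rw [S'_ninj hz', S'_ninj hz, mul_zero]
  obtain ⟨h12, h1⟩ := scalingDimension_mem_Icc_holds ρ Δ S' hlim' hsc' hnd' hρ
  exact ⟨Δ, h12, h1, hratio, hcov⟩

end Summit.CriticalPhenomena.Ising3DConformalLimit.Cruxes.IsingEuclidUpgradeR4NonGaussian.FreeCovarianceDeltaDichotomy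

end
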